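import Literature.NumberTheory.EllipticCurves.PAdicLFunctionIntegralityAtTwoAutoProofs
import Literature.NumberTheory.EllipticCurves.PAdicLFunctionDistributionHoldsProofs
import Literature.NumberTheory.EllipticCurves.ModularFormsGamma0Genus
import Literature.NumberTheory.EllipticCurves.ModularSymbolsProofs
import Literature.NumberTheory.EllipticCurves.CuspFormLFunctionLevelConductorProofs
import HarnessLib

/-!
# Route `EisensteinDepletionAtTwo`, crux E1M `DepletedLambdaLawAtTwoMod` (stmt-BirchSwinnertonDyer-20341), line `star` v3.7:
# the CURVE-SIDE KERNEL ASK `stub_starPlusPrimitive` — the plus cusp functional `X_f(b,d) = [b/d]⁺_f − [0]⁺_f` of a rational newform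
# has the GLOBAL PRIMITIVE SCALE `½`: it is half-integral at every cusp `b/d` with `gcd(d, bN) = 1`, and ODD (an odd multiple of `½`)
# at one of them

Cell `bsd-rank2` (HOME run/shared/lean/pub/bsd-rank2/), seat `bsd-rank2-eng` GEN 10 (helper `--supports` the crux item; the lead's
v3.7 stub `stub_starPlusPrimitive` quantifies the coprimality against `N_W = W.conductorNorm ℤ`, which equals the level of `f` by the
squarefree Atkin–Lehner theorem or by the line's modularity clause — both variants are given, the general one with `N = N_W` as a
hypothesis). PROOF (all Literature, no named fact): for a rational newform `f ∈ S₂(Γ₀(N))` the real period `Ω⁺_f` is positive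
(`IsNewform0.plusPeriod_pos_holds`) and `re Λ_f = ℤ·(Ω⁺_f/2)` (`realPeriods_eq_zmultiples_of_plusPeriod_ne_zero`); `Λ_f` is generated by
the cusp-to-cusp periods `{∞, γ∞}` (`periodLattice` is the closure of `cuspSymbol`), so SOME `γ ∈ Γ₀(N)` has `re{∞, γ∞} = k·Ω⁺/2` with
`k` ODD (otherwise `re Λ_f ⊆ ℤΩ⁺`, contradicting `Ω⁺/2 ∈ re Λ_f`); replacing `γ` by `γT` if necessary (`{∞, T∞} = 0`, `cuspSymbol_mul_holds`)
its lower-right entry is nonzero, and by the Manin relation (`modularSymbol_gamma0_smul_holds` at the cusp `0`)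
`{∞, b/d} − {∞, 0} = {∞, γ∞}` for `γ = (a b; c d)`, so `[b/d]⁺ − [0]⁺ = k/2` (`plusSymbol_eq_re_holds`, `ratCast_ratPlusSymbol_holds`),
`gcd(d, bN) = 1` from `ad − bc = 1`, `N ∣ c`. Half-integrality at every such cusp is `exists_ratPlusSymbol_eq_add_div_two`.

* **`exists_odd_re_cuspSymbol`** — some `γ ∈ Γ₀(N)` has `re(cuspSymbol f γ) = k·(Ω⁺_f/2)` with `k` odd;
* **`exists_odd_plusCusp`** — some cusp `b/d`, `d > 0`, `gcd(d, bN) = 1`, has `[b/d]⁺_f − [0]⁺_f = k/2` with `k` odd;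
* **`plusCusp_half_integral`** — `[b/d]⁺_f − [0]⁺_f ∈ ½ℤ` for every such cusp;
* **`starPlusPrimitive_level`** — the body of `StarPlusPrimitive` with the coprimality against the LEVEL `N` of `f`;
* **`starPlusPrimitive_of_level_eq`**, **`starPlusPrimitive_of_squarefree`** — the body of `StarPlusPrimitive` verbatim (coprimality
  against `N_W`), given `N = N_W` resp. `N_W` squarefree (`IsNewformOf.level_eq_conductorNorm_of_squarefree`).

THEOREMS ONLY; no `sorry`; standard axioms. PARTITION: none — r_an ≥ 2, summit axis S0 (D-0036(1)); TWIN (D-0056): n/a.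
B1 honesty: period-lattice bookkeeping (Manin–Drinfeld / Eichler–Shimura level, all tree theorems); nothing reads an analytic rank;
no S0 motion; (★-SymbGlobal), E1M and BSD are NOT proved by this.

References: Ju. I. Manin, *Izv. AN SSSR* 36 (1972) Prop. 1.4, Thm. 1.6 [Manin1972]; J. E. Cremona, *Algorithms for modular elliptic
curves* (1997) §2.8 [CremonaAlgorithms1997]; B. Mazur, J. Tate, J. Teitelbaum, *Invent. Math.* 84 (1986) §I.8 [MazurTateTeitelbaum1986Invent].
-/

set_option linter.dupNamespace false

noncomputable section

open scoped MatrixGroups ModularForm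

open CongruenceSubgroup Matrix.SpecialLinearGroup ModularGroup
open Literature.NumberTheory.EllipticCurves Literature.NumberTheory.EllipticCurves.ModularForms

namespace Summit.BirchSwinnertonDyer.BirchSwinnertonDyer.Theorems.DepletionAtTwo

variable {N : ℕ} [NeZero N] {f : CuspForm (Gamma0 N) 2}

/-- **Some cusp-to-cusp period of a rational newform has real part an ODD multiple of `Ω⁺_f/2`** (`re Λ_f = ℤ·Ω⁺_f/2` is
generated by the real parts of the `{∞, γ∞}_f`, so they cannot all be even multiples). [cite: CremonaAlgorithms1997, §2.8]
[cite: Manin1972, Prop. 1.4 and Thm. 1.6] -/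
theorem exists_odd_re_cuspSymbol (hf : IsNewform0 f) (hQ : coeffField f = ⊥) :
    ∃ γ : Gamma0 N, ∃ k : ℤ, Odd k ∧ (cuspSymbol f γ).re = k * (plusPeriod f / 2) := by
  have hpos : 0 < plusPeriod f := IsNewform0.plusPeriod_pos_holds hf hQ
  obtain ⟨hre, -⟩ := realPeriods_eq_zmultiples_of_plusPeriod_ne_zero f hpos.ne'
  by_contra hcon
  push Not at hcon
  -- every generator has real part in `ℤ·Ω⁺`
  set K : AddSubgroup ℂ := (AddSubgroup.zmultiples (plusPeriod f)).comap Complex.reLm.toAddMonoidHom with hK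
  have hgen : Set.range (cuspSymbol f) ⊆ (K : Set ℂ) := by
    rintro z ⟨γ, rfl⟩
    have hmem : (cuspSymbol f γ).re ∈ realPeriods f :=
      AddSubgroup.mem_map_of_mem (Complex.reLm.toAddMonoidHom) (cuspSymbol_mem_periodLattice f γ)
    rw [hre, AddSubgroup.mem_zmultiples_iff] at hmem
    obtain ⟨k, hk⟩ := hmem
    rw [zsmul_eq_mul] at hk
    have hkeven : ¬ Odd k := fun hodd ↦ hcon γ k hodd hk.symm
    obtain ⟨j, hj⟩ := Int.not_odd_iff_even.mp hkeven
    rw [hK, SetLike.mem_coe, AddSubgroup.mem_comap, AddSubgroup.mem_zmultiples_iff]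
    refine ⟨j, ?_⟩
    change j • plusPeriod f = (cuspSymbol f γ).re
    rw [← hk, hj, zsmul_eq_mul]
    push_cast
    ring
  have hle : periodLattice f ≤ K := (AddSubgroup.closure_le K).mpr hgen
  -- but `Ω⁺/2 ∈ re Λ_f`
  have hhalf : plusPeriod f / 2 ∈ realPeriods f := by
    rw [hre]; exact AddSubgroup.mem_zmultiples _
  obtain ⟨z, hz, hzre⟩ := AddSubgroup.mem_map.mp hhalf
  have hzK := hle hz
  rw [hK, AddSubgroup.mem_comap, AddSubgroup.mem_zmultiples_iff] at hzK
  obtain ⟨m, hm⟩ := hzK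
  change m • plusPeriod f = (Complex.reLm.toAddMonoidHom) z at hm
  rw [hzre, zsmul_eq_mul] at hm
  have h2 : ((2 * m - 1 : ℤ) : ℝ) * plusPeriod f = 0 := by push_cast; linarith
  rcases mul_eq_zero.mp h2 with h | h
  · have : (2 * m - 1 : ℤ) = 0 := by exact_mod_cast h
    omega
  · exact hpos.ne' h

omit [NeZero N] in
/-- `γ ∈ Γ₀(N)` has `gcd(d, b·N) = 1` (`ad − bc = 1`, `N ∣ c`). [folklore] -/
theorem int_gcd_eq_one_of_gamma0 (γ : Gamma0 N) :
    Int.gcd ((γ : SL(2, ℤ)) 1 1) ((γ : SL(2, ℤ)) 0 1 * N) = 1 := by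
  have hc : (N : ℤ) ∣ (γ : SL(2, ℤ)) 1 0 := (ZMod.intCast_zmod_eq_zero_iff_dvd _ N).mp (Gamma0_mem.mp γ.2)
  obtain ⟨c', hc'⟩ := hc
  have hdet := Matrix.SpecialLinearGroup.det_coe (γ : SL(2, ℤ))
  rw [Matrix.det_fin_two, hc'] at hdet
  exact Int.isCoprime_iff_gcd_eq_one.mp ⟨(γ : SL(2, ℤ)) 0 0, -c', by linear_combination hdet⟩

/-- **An ODD plus cusp value**: for a rational newform `f ∈ S₂(Γ₀(N))` there is a cusp `b/d` (`d > 0`, `gcd(d, bN) = 1`) with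
`[b/d]⁺_f − [0]⁺_f = k/2`, `k` odd. [cite: Manin1972, Prop. 1.4 and Thm. 1.6] [cite: CremonaAlgorithms1997, §2.8]
[cite: MazurTateTeitelbaum1986Invent, §I.8] -/
theorem exists_odd_plusCusp (hf : IsNewform0 f) (hQ : coeffField f = ⊥) :
    ∃ b d : ℤ, 0 < d ∧ Int.gcd d (b * N) = 1 ∧
      ∃ k : ℤ, ratPlusSymbol f ((b : ℚ) / (d : ℚ)) - ratPlusSymbol f 0 = (k : ℚ) * (1 / 2) ∧ Odd k := by
  have hreal := cuspCoeff_im_eq_zero_of_coeffField_eq_bot hQ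
  have hpos : 0 < plusPeriod f := IsNewform0.plusPeriod_pos_holds hf hQ
  obtain ⟨γ₀, k, hk, hγ₀⟩ := exists_odd_re_cuspSymbol hf hQ
  -- arrange `d ≠ 0` by passing to `γ₀ T` if necessary (`{∞, T∞} = 0`)
  obtain ⟨γ, hγre, hd0⟩ : ∃ γ : Gamma0 N, (cuspSymbol f γ).re = k * (plusPeriod f / 2) ∧ (γ : SL(2, ℤ)) 1 1 ≠ 0 := by
    by_cases h0 : (γ₀ : SL(2, ℤ)) 1 1 ≠ 0
    · exact ⟨γ₀, hγ₀, h0⟩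
    · push Not at h0
      have hTmem : ModularGroup.T ∈ Gamma0 N := by rw [Gamma0_mem]; simp [ModularGroup.coe_T]
      refine ⟨γ₀ * ⟨ModularGroup.T, hTmem⟩, ?_, ?_⟩
      · have hT0 : cuspSymbol f ⟨ModularGroup.T, hTmem⟩ = 0 := by
          simp [cuspSymbol, ModularGroup.coe_T]
        rw [cuspSymbol_mul_holds f γ₀ ⟨ModularGroup.T, hTmem⟩, hT0, add_zero, hγ₀]
      · have hdet := Matrix.SpecialLinearGroup.det_coe (γ₀ : SL(2, ℤ))
        rw [Matrix.det_fin_two, h0, mul_zero, zero_sub] at hdet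
        have hc : (γ₀ : SL(2, ℤ)) 1 0 ≠ 0 := by
          intro hc; rw [hc, mul_zero, neg_zero] at hdet; exact zero_ne_one hdet
        change ((γ₀ : SL(2, ℤ)) * ModularGroup.T) 1 1 ≠ 0
        rw [Matrix.SpecialLinearGroup.coe_mul]
        simp [ModularGroup.coe_T, Matrix.mul_apply, Fin.sum_univ_two, h0, hc]
  set a : ℤ := (γ : SL(2, ℤ)) 0 0 with ha
  set b : ℤ := (γ : SL(2, ℤ)) 0 1 with hb
  set c : ℤ := (γ : SL(2, ℤ)) 1 0 with hc
  set d : ℤ := (γ : SL(2, ℤ)) 1 1 with hd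
  -- the Manin relation at the cusp `0`: `{∞, b/d} = {∞, γ∞} + {∞, 0}`
  have hman := modularSymbol_gamma0_smul_holds f γ 0 (by rw [mul_zero, zero_add]; exact_mod_cast hd0)
  rw [mul_zero, zero_add, mul_zero, zero_add, ← hb, ← hd] at hman
  -- the rational plus symbols
  have hdiff : ratPlusSymbol f ((b : ℚ) / (d : ℚ)) - ratPlusSymbol f 0 = (k : ℚ) * (1 / 2) := by
    apply Rat.cast_injective (α := ℝ)
    push_cast
    rw [ratCast_ratPlusSymbol_holds hf hQ, ratCast_ratPlusSymbol_holds hf hQ, normalizedPlusSymbol, normalizedPlusSymbol,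
      plusSymbol_eq_re_holds f hreal, plusSymbol_eq_re_holds f hreal, Complex.ofReal_re, Complex.ofReal_re, hman,
      Complex.add_re, hγre]
    field_simp
    ring
  have hgcd : Int.gcd d (b * N) = 1 := int_gcd_eq_one_of_gamma0 γ
  rcases lt_or_gt_of_ne hd0 with hneg | hposd
  · refine ⟨-b, -d, by omega, by rw [neg_mul, Int.neg_gcd, Int.gcd_neg]; exact hgcd, k, ?_, hk⟩
    push_cast
    rw [neg_div_neg_eq]
    exact hdiff
  · exact ⟨b, d, hposd, hgcd, k, hdiff, hk⟩

/-- **Half-integrality at every cusp equivalent to `0`**: `[b/d]⁺_f − [0]⁺_f ∈ ½ℤ` for `gcd(d, bN) = 1`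
(`exists_ratPlusSymbol_eq_add_div_two`; the denominator of `b/d` divides `d`). [cite: MazurTateTeitelbaum1986Invent, §I.8]
[cite: Manin1972, Prop. 1.4 and Thm. 1.6] -/
theorem plusCusp_half_integral (hQ : coeffField f = ⊥) {b d : ℤ} (hg : Int.gcd d (b * N) = 1) :
    ∃ n : ℤ, ratPlusSymbol f ((b : ℚ) / (d : ℚ)) - ratPlusSymbol f 0 = (n : ℚ) * (1 / 2) := by
  have hreal := cuspCoeff_im_eq_zero_of_coeffField_eq_bot hQ
  have hcopZ : IsCoprime d (b * N) := Int.isCoprime_iff_gcd_eq_one.mpr hg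
  have hdN : Int.gcd d (N : ℤ) = 1 := Int.isCoprime_iff_gcd_eq_one.mp hcopZ.of_mul_right_right
  have hden : ((((b : ℚ) / (d : ℚ)).den : ℤ)) ∣ d := by
    rw [Rat.intCast_div_eq_divInt]; exact Rat.den_dvd b d
  have hx : Nat.Coprime (((b : ℚ) / (d : ℚ)).den) N := by
    have h1 : Nat.Coprime d.natAbs N := by
      rw [Int.gcd_eq_natAbs, Int.natAbs_natCast] at hdN; exact hdN
    exact Nat.Coprime.coprime_dvd_left (by
      have := Int.natAbs_dvd_natAbs.mpr hden
      rwa [Int.natAbs_natCast] at this) h1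
  obtain ⟨n, hn⟩ := exists_ratPlusSymbol_eq_add_div_two f hreal hx
  exact ⟨n, by rw [hn]; ring⟩

/-- **`StarPlusPrimitive` at the LEVEL of `f`**: for a rational newform `f ∈ S₂(Γ₀(N))`, `g = ½` is a global primitive scale of
`X_f = [b/d]⁺ − [0]⁺` on the cusps `b/d`, `d > 0`, `gcd(d, bN) = 1`: integral everywhere, odd somewhere.
[cite: CremonaAlgorithms1997, §2.8] [cite: MazurTateTeitelbaum1986Invent, §I.8] -/
theorem starPlusPrimitive_level (hf : IsNewform0 f) (hQ : coeffField f = ⊥) :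
    ∃ g : ℚ, g ≠ 0 ∧
      (∀ b d : ℤ, 0 < d → Int.gcd d (b * N) = 1 →
        ∃ n : ℤ, ratPlusSymbol f ((b : ℚ) / (d : ℚ)) - ratPlusSymbol f 0 = n * g) ∧
      (∃ b d : ℤ, 0 < d ∧ Int.gcd d (b * N) = 1 ∧
        ∃ n : ℤ, ratPlusSymbol f ((b : ℚ) / (d : ℚ)) - ratPlusSymbol f 0 = n * g ∧ Odd n) :=
  ⟨1 / 2, by norm_num, fun _ _ _ hg ↦ plusCusp_half_integral hQ hg, exists_odd_plusCusp hf hQ⟩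

/-- **`StarPlusPrimitive` (the v3.7 stub's body, coprimality against `N_W`) when the level of `f` IS `N_W`** — e.g. for the newform
supplied by the line's modularity clause at level `N_W`, or via `IsNewformOf.level_eq_conductorNorm_of_exists_isNewformOf`.
[cite: CremonaAlgorithms1997, §2.8] [cite: MazurTateTeitelbaum1986Invent, §I.8] -/
theorem starPlusPrimitive_of_level_eq (W : WeierstrassCurve ℚ) (f : CuspForm (Gamma0 N) 2) (hf : IsNewformOf W f)
    (hNW : N = W.conductorNorm ℤ) :
    ∃ g : ℚ, g ≠ 0 ∧
      (∀ b d : ℤ, 0 < d → Int.gcd d (b * (W.conductorNorm ℤ : ℕ)) = 1 →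
        ∃ n : ℤ, ratPlusSymbol f ((b : ℚ) / (d : ℚ)) - ratPlusSymbol f 0 = n * g) ∧
      (∃ b d : ℤ, 0 < d ∧ Int.gcd d (b * (W.conductorNorm ℤ : ℕ)) = 1 ∧
        ∃ n : ℤ, ratPlusSymbol f ((b : ℚ) / (d : ℚ)) - ratPlusSymbol f 0 = n * g ∧ Odd n) := by
  subst hNW
  exact starPlusPrimitive_level hf.1 hf.coeffField_eq_bot

/-- **`StarPlusPrimitive` (the v3.7 stub's body) for SQUAREFREE conductor**, unconditionally: the level of a newform of `W` is
`N_W` by Atkin–Lehner (`IsNewformOf.level_eq_conductorNorm_of_squarefree`). [cite: CremonaAlgorithms1997, §2.8]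
[cite: MazurTateTeitelbaum1986Invent, §I.8] -/
theorem starPlusPrimitive_of_squarefree (W : WeierstrassCurve ℚ) [W.IsElliptic] (hsq : Squarefree (W.conductorNorm ℤ))
    (f : CuspForm (Gamma0 N) 2) (hf : IsNewformOf W f) :
    ∃ g : ℚ, g ≠ 0 ∧
      (∀ b d : ℤ, 0 < d → Int.gcd d (b * (W.conductorNorm ℤ : ℕ)) = 1 →
        ∃ n : ℤ, ratPlusSymbol f ((b : ℚ) / (d : ℚ)) - ratPlusSymbol f 0 = n * g) ∧
      (∃ b d : ℤ, 0 < d ∧ Int.gcd d (b * (W.conductorNorm ℤ : ℕ)) = 1 ∧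
        ∃ n : ℤ, ratPlusSymbol f ((b : ℚ) / (d : ℚ)) - ratPlusSymbol f 0 = n * g ∧ Odd n) :=
  starPlusPrimitive_of_level_eq W f hf (hf.level_eq_conductorNorm_of_squarefree hsq)

end Summit.BirchSwinnertonDyer.BirchSwinnertonDyer.Theorems.DepletionAtTwo

end
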